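import Mathlib
import HarnessLib
import Summits.HubbardSuperconductivity.HubbardSuperconductivity.Theorems.KLProgrammeKLRegimeEnginePairLadderTowerShaped

/-!
# Route `KLProgramme` — crux K3, ENGINE child (gen 6 stmt-…-20236 `KLRegimeEngineV16`; gen 7-flow twin at K := K_n), stub `stub_engine_step_values`,
# conjunct (E2-v10) at `1 ≤ n`: the composed budget of the FORWARD tower on shaped majorants — `kltc_tower_budget_shaped_fwd`

Cell gate-hubbard-kl, seat hubbard-kl-k3c1-p1 (g7), technique «composed-map remainder propagation».  `kltc_tower_budget_shaped` (p495632) discharges the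
error `E″ + FT_σ(E₁)` of the INVERTED-form composition (`kltc_tower_compose`).  The forward form of record (`kltc_tower_compose_fwd` p496062,
`kltc_pairClass_compose_fwd` / `pairLadderStepAtV10_of_wickTower_fwd` p518064, the scale-flow doors p519462 / p523369) has the final error `FT_σ(E₂)` with
`E₂ = E_R + E₁`, `E₁ = E_a + FT_ρ(R′)` — the straddle error `E_R` of scale `n` is dressed too.  This file discharges THAT form, with row/column leg
coefficients allowed to differ (the inner scale-flow level produces asymmetric ones):

* **`kltc_tower_budget_shaped_fwd`** — from shaped `R′ ≤ u′ + l′_R λ(x) + l′_C λ(y) + c′Φ`, `E_a ≤ u_a + l_{aR} λ(x) + l_{aC} λ(y) + c_aΦ`,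
  `E_R ≤ u″ + l″_R λ(x) + l″_C λ(y) + c″Φ` (`Φ = φ(x−y) + φ(x+y−Q)`, `φ` even, `λ, φ ≥ 0`), the masses `(Z₁, Λ₁, ε₁)` of `ρ = |w₁|` and `(Z₂, Λ₂, ε₂)` of
  `σ = |b|`, and the four-term coefficients `(p₁,q₁,r₁)`, `(p₂,q₂,r₂)`: with `E₁ := E_a + FT_ρ(R′)` and `E₂ := E_R + E₁` (EQUALITIES — pass them to the doors'
  `hE₁`/`hE₂` by `le_rfl`), `FT_σ(E₂)(x,y) ≤ U_f + L_R λ(x) + L_C λ(y) + (c′ + c_a + c″)Φ(x,y)` with `U_f, L_R, L_C` given by equations (pass `rfl`);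
  feed `kltc_budgetLineV10_of_shaped` (…TowerShapedMap) with `λ(p) = 𝟙(p) + 𝟙(Q − p)`-type legs to reach the slot line.

Arithmetic only; nothing about the model is asserted.  0 kit.
-/

noncomputable section

namespace Summit.HubbardSuperconductivity.HubbardSuperconductivity.Theorems.KLRegimeSplit

set_option linter.dupNamespace false -- summit = problem name (single-conjunct summit), D-0017

open Finset

section Shaped

variable {S : Type*} [Fintype S] [AddCommGroup S]

omit [AddCommGroup S] in
/-- Leg-weighted mass with a scalar coefficient: `Σ_a ρ_a·(l·λ_a) = l·Σ_a ρ_aλ_a ≤ l·Λ` for `l ≥ 0`. -/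
theorem kltc_legMass_scale (ρ lam : S → ℝ) {l Λ : ℝ} (hl : 0 ≤ l) (hΛ : ∑ a, ρ a * lam a ≤ Λ) :
    ∑ a, ρ a * (l * lam a) ≤ l * Λ := by
  calc ∑ a, ρ a * (l * lam a) = l * ∑ a, ρ a * lam a := by rw [mul_sum]; exact sum_congr rfl fun a _ => by ring
    _ ≤ l * Λ := mul_le_mul_of_nonneg_left hΛ hl

set_option maxHeartbeats 400000 in -- two shaped four-term levels + linear bookkeeping
/-- **The composed budget of the forward tower on shaped majorants.**  See the module docstring.  Inputs: the three shaped majorants, the two weight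
profiles' masses, nonnegative coefficients; `E₁ = E_a + FT_ρ(R′)` and `E₂ = E_R + E₁` as equations; the output constants `U₁` (level-1 uniform part),
`L_R, L_C` (final leg coefficients) and `U_f` (final uniform part) as equations.  Output: `FT_σ(E₂)(x,y) ≤ U_f + L_R·λ(x)·(1 + p₂Z₂) … ` — precisely
`FT_σ(E₂)(x,y) ≤ U_f + (1 + p₂Z₂)·L_R·λ(x) + (1 + q₂Z₂)·L_C·λ(y) + (c′ + c_a + c″)·(φ(x−y) + φ(x+y−Q))`. -/
theorem kltc_tower_budget_shaped_fwd (R' Ea ER E₁ E₂ : S → S → ℝ) (ρ σ lam φ : S → ℝ) (Q : S)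
    {u' ua u'' l'R l'C laR laC l''R l''C c' ca c'' p₁ q₁ r₁ p₂ q₂ r₂ Z₁ Z₂ Λ₁ Λ₂ ε₁ ε₂ U₁ LR LC Uf : ℝ}
    (hu' : 0 ≤ u') (hua : 0 ≤ ua) (hu'' : 0 ≤ u'') (hl'R : 0 ≤ l'R) (hl'C : 0 ≤ l'C) (hlaR : 0 ≤ laR) (hlaC : 0 ≤ laC)
    (hl''R : 0 ≤ l''R) (hl''C : 0 ≤ l''C) (hc' : 0 ≤ c') (hca : 0 ≤ ca) (hc'' : 0 ≤ c'')
    (hp₁ : 0 ≤ p₁) (hq₁ : 0 ≤ q₁) (hr₁ : 0 ≤ r₁) (hp₂ : 0 ≤ p₂) (hq₂ : 0 ≤ q₂) (hr₂ : 0 ≤ r₂)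
    (hρ : ∀ a, 0 ≤ ρ a) (hσ : ∀ a, 0 ≤ σ a) (hlam : ∀ a, 0 ≤ lam a) (hφ0 : ∀ v, 0 ≤ φ v) (hφ : ∀ v, φ (-v) = φ v)
    (hR' : ∀ x y, R' x y ≤ u' + l'R * lam x + l'C * lam y + c' * (φ (x - y) + φ (x + y - Q)))
    (hEa : ∀ x y, Ea x y ≤ ua + laR * lam x + laC * lam y + ca * (φ (x - y) + φ (x + y - Q)))
    (hER : ∀ x y, ER x y ≤ u'' + l''R * lam x + l''C * lam y + c'' * (φ (x - y) + φ (x + y - Q)))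
    (hZ₁ : ∑ a, ρ a ≤ Z₁) (hΛ₁ : ∑ a, ρ a * lam a ≤ Λ₁) (hang₁ : ∀ c₀ : S, ∑ b, ρ b * φ (b - c₀) ≤ ε₁)
    (hZ₂ : ∑ a, σ a ≤ Z₂) (hΛ₂ : ∑ a, σ a * lam a ≤ Λ₂) (hang₂ : ∀ c₀ : S, ∑ b, σ b * φ (b - c₀) ≤ ε₂)
    (hE₁ : ∀ x y, E₁ x y = Ea x y + (R' x y + p₁ * ∑ b, R' x b * ρ b + q₁ * ∑ a, ρ a * R' a y + r₁ * ∑ a, ∑ b, ρ a * R' a b * ρ b))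
    (hE₂ : ∀ x y, E₂ x y = ER x y + E₁ x y)
    (hU₁ : U₁ = u' * (1 + p₁ * Z₁ + q₁ * Z₁ + r₁ * Z₁ * Z₁) + p₁ * (l'C * Λ₁) + q₁ * (l'R * Λ₁) + r₁ * Z₁ * (l'R * Λ₁ + l'C * Λ₁) +
      2 * c' * ε₁ * (p₁ + q₁ + r₁ * Z₁))
    (hLR : LR = l''R + laR + (1 + p₁ * Z₁) * l'R) (hLC : LC = l''C + laC + (1 + q₁ * Z₁) * l'C)
    (hUf : Uf = (u'' + ua + U₁) * (1 + p₂ * Z₂ + q₂ * Z₂ + r₂ * Z₂ * Z₂) + p₂ * (LC * Λ₂) + q₂ * (LR * Λ₂) + r₂ * Z₂ * (LR * Λ₂ + LC * Λ₂) +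
      2 * (c' + ca + c'') * ε₂ * (p₂ + q₂ + r₂ * Z₂)) (x y : S) :
    E₂ x y + p₂ * ∑ b, E₂ x b * σ b + q₂ * ∑ a, σ a * E₂ a y + r₂ * ∑ a, ∑ b, σ a * E₂ a b * σ b ≤
      Uf + (1 + p₂ * Z₂) * (LR * lam x) + (1 + q₂ * Z₂) * (LC * lam y) + (c' + ca + c'') * (φ (x - y) + φ (x + y - Q)) := by
  have hZ₁0 : 0 ≤ Z₁ := (sum_nonneg fun a _ => hρ a).trans hZ₁
  have hΛ₁0 : 0 ≤ Λ₁ := (sum_nonneg fun a _ => mul_nonneg (hρ a) (hlam a)).trans hΛ₁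
  have hε₁0 : 0 ≤ ε₁ := (sum_nonneg fun b _ => mul_nonneg (hρ b) (hφ0 _)).trans (hang₁ x)
  -- level 1: the shape of `FT_ρ(R′)`
  have h1 : ∀ a b, R' a b + p₁ * ∑ t, R' a t * ρ t + q₁ * ∑ s, ρ s * R' s b + r₁ * ∑ s, ∑ t, ρ s * R' s t * ρ t ≤
      (u' * (1 + p₁ * Z₁ + q₁ * Z₁ + r₁ * Z₁ * Z₁) + p₁ * (l'C * Λ₁) + q₁ * (l'R * Λ₁) + r₁ * Z₁ * (l'R * Λ₁ + l'C * Λ₁) +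
          2 * c' * ε₁ * (p₁ + q₁ + r₁ * Z₁)) +
        (1 + p₁ * Z₁) * (l'R * lam a) + (1 + q₁ * Z₁) * (l'C * lam b) + c' * (φ (a - b) + φ (a + b - Q)) := fun a b =>
    kltc_fourTerm_shaped_le R' ρ (fun s => l'R * lam s) (fun s => l'C * lam s) φ Q hu' hc' hp₁ hq₁ hr₁ hρ
      (fun s => mul_nonneg hl'R (hlam s)) (fun s => mul_nonneg hl'C (hlam s)) hφ0 hφ hR' hZ₁ (kltc_legMass_scale ρ lam hl'R hΛ₁)
      (kltc_legMass_scale ρ lam hl'C hΛ₁) hang₁ a b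
  have hU₁0 : 0 ≤ U₁ := by rw [hU₁]; positivity
  -- the shape of `E₂ = E_R + E_a + FT_ρ(R′)`
  have hLR0 : 0 ≤ LR := by rw [hLR]; positivity
  have hLC0 : 0 ≤ LC := by rw [hLC]; positivity
  have hE₂shape : ∀ a b, E₂ a b ≤ (u'' + ua + U₁) + LR * lam a + LC * lam b + (c' + ca + c'') * (φ (a - b) + φ (a + b - Q)) := by
    intro a b
    rw [hE₂, hE₁, hLR, hLC]
    have := h1 a b
    rw [← hU₁] at this
    linarith [hER a b, hEa a b, this]
  -- level 2: `FT_σ(E₂)`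
  have h2 := kltc_fourTerm_shaped_le E₂ σ (fun s => LR * lam s) (fun s => LC * lam s) φ Q (by positivity : 0 ≤ u'' + ua + U₁)
    (by positivity : 0 ≤ c' + ca + c'') hp₂ hq₂ hr₂ hσ (fun s => mul_nonneg hLR0 (hlam s)) (fun s => mul_nonneg hLC0 (hlam s)) hφ0 hφ
    hE₂shape hZ₂ (kltc_legMass_scale σ lam hLR0 hΛ₂) (kltc_legMass_scale σ lam hLC0 hΛ₂) hang₂ x y
  rw [hUf]
  linarith [h2]

end Shaped

end Summit.HubbardSuperconductivity.HubbardSuperconductivity.Theorems.KLRegimeSplit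

end
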